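import Mathlib
import Literature.NumberTheory.EllipticCurves.BurungaleCastellaGrossiSkinner2026.RefinedKolyvaginConjecture
import Literature.NumberTheory.EllipticCurves.HeegnerPointsKolyvaginTorsionProofs
import Literature.NumberTheory.EllipticCurves.HeegnerPointsKolyvaginPrimitivity
import Literature.NumberTheory.EllipticCurves.HeegnerPointsKolyvaginLevelOneStructure
import HarnessLib

/-!
# HeegnerPointsKolyvaginModPRigidity

Topic `Literature/NumberTheory/EllipticCurves`. Named literature fact(s) relocated by the gate from `Summits/BirchSwinnertonDyer/BirchSwinnertonDyer/Theorems/KolyvaginDepthDoorKNSupplyModPRigidity.lean`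
(accept-time relocation of `[cite]`d propositions written inline in a Summits proposal; human ruling 2026-08-15).
Sources: Howard2004, Kolyvagin1991MathAnn, WZhang2014, Zanarella2019.

* `Literature.NumberTheory.EllipticCurves.HowardZanarella_exists_minimal_kolyvaginClass_one_selmerCard_of_ne_zero`
-/

namespace Literature.NumberTheory.EllipticCurves

open scoped Classical
open Literature.NumberTheory.EllipticCurves Literature.NumberTheory.EllipticCurves.ModularForms WeierstrassCurve

/-- **Howard 2004 / Zanarella 2019 — rigidity of the MOD-`p` Heegner-point Kolyvagin system: a
non-zero mod-`p` system does not vanish at the core vertices, and the shallowest core vertex has depth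
`max(dim Sel_p(E/ℚ), dim Sel_p(E^{(d_K)}/ℚ)) − 1`** (B. Howard, Compos. Math. 140 (2004) 1439–1472
= arXiv:1202.6340; M. Zanarella, arXiv:1908.09197 (2019); THEOREMS of the sources, composed as recorded
below; it is W. Zhang's Lemma 8.4 (1) with Def. 8.3 (Camb. J. Math. 2 (2014) p. 236, *"can be proved
with the techniques in [Kolyvagin], [McCallum]"*) WITHOUT his Hypothesis ♠, the non-vanishing of the
mod-`p` system being a HYPOTHESIS here instead of his Thm. 9.1).
PRINTED STATEMENTS (held texts `paper:arxiv-1202.6340` = Howard, chunk locators `pNNNN Lnn`, numbering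
of the held text = Compositio numbering with first index `+1`; `paper:arxiv-1908.09197` = Zanarella).
(H-a) Howard Thm. 1 / §1.7 [p0003 L23–L70, p0012 L128–L139, p0014 L26–L38]: `E/ℚ` of conductor `N`,
`K` imaginary quadratic of discriminant `D ≠ −3, −4` with all primes dividing `N` split in `K`, `p` odd
with `p`, `D`, `N` pairwise coprime and `Gal(K̄/K) → Aut_{ℤ_p}(T_pE)` surjective, a FIXED modular
parametrisation, `𝓛 = 𝓛_1(T)`; the classes `κ_n ∈ H¹_{𝓕(n)}(K, T/I_nT) ⊗ G_n` obtained from the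
Heegner points `P[n]` by the Kummer map and Kolyvagin's derivative `D_n` form, after the automorphism
`χ_n` of `H¹(K, T/I_nT)` (Thm. 1.7.5, proof: `κ'_n = χ_n^{−1}(κ_n) ⊗ σ`), a Kolyvagin system for
`(T_pE, 𝓕, 𝓛)` in the sense of Def. 1.2.3, where `H¹_{𝓕(1)}(K, T) = S_p(E/K)` [p0003 L52–L53] and
`𝓕(n)` is `𝓕` made transverse at the primes dividing `n` (Def. 1.2.2); Thm. 1.6.5, proof [p0012
L86–L116]: the Selmer triple `(T_p(E), 𝓕, 𝓛_s)` satisfies H.0–H.5 (H.1/H.2 from the surjectivity,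
H.5 "using the fact that `E` is defined over `ℚ`"). (H-b) Thm. 1.4.2 / (1.5 display) [p0010 L45–L55]
for a principal Artinian `R` of length `k` and a triple satisfying H.0–H.5: `𝓗(n) := H¹_{𝓕(n)}(K, T)
≃ R^ε ⊕ M(n) ⊕ M(n)`, `ε ∈ {0, 1}`; Def. 1.5.2 [p0009 L136–L137]: `ρ(n)^± = dim_{R/𝔪} 𝓗̄(n)^±`,
`ρ(n) = ρ(n)⁺ + ρ(n)⁻` (`𝓗̄(n) = H¹_{𝓕(n)}(K, T̄)`, `T̄ = T/𝔪T`, `±` the eigenspaces of complex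
conjugation `τ`); Lemma 1.5.3 [p0009 L139–L148] = Zanarella Lemma 2.8 [p0008 L110–L115]: for `nℓ ∈ 𝒩`,
*"if `loc_ℓ(𝓗̄(n)^±) ≠ 0` then `ρ(nℓ)^± = ρ(n)^± − 1` …, if `loc_ℓ(𝓗̄(n)^±) = 0` then `ρ(nℓ)^± =
ρ(n)^± + 1`"*; Prop. 1.5.5 [p0010 L67–L77]: *"`ε` … is congruent to `ρ(n) (mod 2)` and is therefore
independent of `n`"*, with `ε + 2 dim M(n)[𝔪] = ρ(n)`; Def. 1.5.4 [p0010 L57–L62]: `λ(n) = len M(n)`,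
the stub module `𝒮(n) = 𝔪^{λ(n)} 𝓗(n)`; Lemma 1.6.4 [p0011 L122–L124]: *"If `n ∈ 𝒩^{(2k−1)}` then
`κ_n^{(k)} ∈ 𝒮^{(k)}(n) ⊗ G_n`"* (`R^{(k)} = R/𝔪^k`, `T^{(k)} = T/𝔪^kT`, `κ^{(k)}` the image system).
(Z-a) Zanarella §2.2 (`R` principal Artinian of length `k`, `𝓛 ⊆ 𝓛_k(T)`), Def. 2.7 [p0008 L105–L106]:
*"We call `n ∈ 𝒩` a core vertex if `ρ(n) = 1`. … under (ε = 1), this is equivalent to `M(n) = 0` and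
also to `𝓗(n) ≃ R`"*; Cor. 2.12 [p0009 L75–L76]: *"Assume `p > 3`, and let `s ≥ 1`. Let `r(n) :=
max(ρ(n)⁺, ρ(n)⁻)`. Let `n ∈ 𝒩` be such that `r(n) > 1` and let `0 ≠ c ∈ 𝓗(n)`. Then there is a
positive proportion of primes `l ∈ 𝓛_s(T)` such that `loc_l(c) ≠ 0` and `r(nl) < r(n)`"*; Cor. 2.14
[p0010 L50–L55]: *"Let `κ ∈ KS(T, 𝓕, 𝓛)`, `p > 4` and `𝓛 ⊇ 𝓛_s(T)` for some `s ≥ 1`. Then there is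
a `k ≥ d ≥ 0` such that for any core vertex `n`, we have `κ_n R = 𝔪^d 𝓗(n)`"*; Prop. 2.15 [p0010
L61–L62]: *"`d = k` if and only if `κ = 0`"*; §2.3, Def. 2.17 / Prop. 2.18, proof [p0011 L19–L40]:
*"We call `κ` primitive if `∂^{(∞)}(κ) = 0`. … `∂^{(∞)}(κ) = 0` is the same as `κ^{(1)} ≠ 0`"*;
Rem. 2.20 + §3.1 [p0011 L50–L51, p0014 L1–L70]: the triple `(T_pE, 𝓕_BK, 𝓛_1(T_pE))` with the
finite-level Kolyvagin system of the Heegner points `P[m] ∈ E(K[m])` (setting: `D_K < −4`,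
`(N_E, D_K) = 1`, (Heeg), (good), (`p` big) `p ≥ 5`, (res-surj), `p ∤ N_E D_K`). (K) Kolyvagin,
Math. Ann. 291 (1991) §2: for odd `p` the `+`-eigenspace of `Sel_p(E/K)` under `τ` is `Sel_p(E/ℚ)` and
the `−`-eigenspace is `Sel_p(E^{(D)}/ℚ)` (*"The group `S^ν_{ℓ^n}` coincides … with the Selmer group of
level `ℓ^n` for `E^ν` over `ℚ`"*; the reading already used by the tree's records
`Kolyvagin1991_selmerCorank_of_kolyvaginClass_ne_zero` and
`WZhang2014_lemma84_exists_minimal_kolyvaginClass_one_selmerCard`).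
DERIVATION (`R = ℤ_p`, `k = 1`: `R^{(1)} = 𝔽_p`, `T^{(1)} = T̄ = E[p]`, `𝒩^{(1)}` = square-free
products of Kolyvagin primes `ℓ` with `M(ℓ) ≥ 1`, `𝓗̄(n) = H¹_{𝓕(n)}(K, E[p])`, `𝓗̄(1) = Sel_p(E/K)`
by (H-a); write `κ̄ = κ^{(1)} = {c_1(n)}`, `r = r(1) = max(ρ(1)⁺, ρ(1)⁻) = max(dim Sel_p(E/ℚ), dim
Sel_p(E^{(D)}/ℚ))` by (K)). (1) At `k = 1`, `𝒮̄(n) = p^{λ(n)} 𝓗̄(n)` is `0` unless `λ(n) = 0`, when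
it is `𝔽_p^ε` (H-b: `𝓗̄(n) ≃ 𝔽_p^ε ⊕ M ⊕ M`); so by Lemma 1.6.4, `c_1(n) ≠ 0` forces `ε = 1` and
`M(n) = 0`, i.e. `ρ(n) = 1`: EVERY `n` WITH `c_1(n) ≠ 0` IS A CORE VERTEX, and `κ̄ ≠ 0` forces `ε = 1`
(so `ρ(m)` is odd for all `m`, Prop. 1.5.5, and Zanarella's standing assumption (ε = 1) holds).
(2) Cor. 2.14 + Prop. 2.15 at `k = 1`: `d ∈ {0, 1}` and `d = 1 ⟺ κ̄ = 0`; so `κ̄ ≠ 0` gives `d = 0` and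
`c_1(n)·𝔽_p = 𝓗̄(n) ≃ 𝔽_p`, i.e. `c_1(n) ≠ 0`, at EVERY core vertex `n ∈ 𝒩^{(1)}`. (3) Depth: by Lemma
1.5.3 each prime changes `ρ⁺` and `ρ⁻` by exactly `±1`, so `r(nℓ) ≥ r(n) − 1`, whence `r(m) ≥ r − ν(m)`
for every `m ∈ 𝒩^{(1)}` and a core vertex (`r(m) = 1`) has `ν(m) ≥ r − 1`; conversely, starting from
`n = 1` and applying Cor. 2.12 (`p ≥ 5 > 3`, `s = 1`; a non-zero `c ∈ 𝓗̄(n)` exists as `ρ(n)` is odd)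
`r − 1` times gives `n ∈ 𝒩^{(1)}` with `ν(n) = r − 1` and `r(n) = 1`, and `ρ(n)` odd with `ρ(n)^± ≤ 1`
forces `ρ(n) = 1`: a CORE VERTEX OF DEPTH EXACTLY `r − 1`, and none shallower. (4) Hence, if `κ̄ ≠ 0`:
there is `n ∈ Λ` with `c_1(n) ≠ 0` and `ν(n) = r − 1` minimal among all `n'` with `c_1(n') ≠ 0` (by (1)
and (3)); and since `ρ(1) = ρ(1)⁺ + ρ(1)⁻` is odd, the smaller of `dim Sel_p(E/ℚ)`, `dim Sel_p(E^{(D)}/ℚ)`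
is `≤ r − 1 = ν(n)` while the larger is `ν(n) + 1` — W. Zhang's Lemma 8.4 (1) dichotomy, read as
cardinalities (`dim = ν+1` ↦ `# = p^{ν+1}`, `dim ≤ ν` ↦ `# ≤ p^ν`).
TRANSCRIPTION (vocabulary of `HeegnerPointsOfConductor` / the BCGS Thm. 2 and Zanarella Prop. 2.18
records, reused verbatim): `W/ℚ` globally minimal elliptic, `N = W.conductorNorm ℤ`; `5 ≤ p` (Z: `p`
big; H/Z Cor. 2.12–2.14: `p > 4`), good reduction at `p` (Z: (good); H: `p ∤ N`), `ρ̄_{E,p}` onto (Z: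
(res-surj)) AND `ρ_{E,p^n}` onto over `ℚ` for every `n` together with `p ∤ d_K`, `(d_K, N) = 1` — which
IMPLY Howard's `Gal(K̄/K) ↠ Aut_{ℤ_p}(T_pE)`: `K` is ramified at a prime `r ∣ d_K`, `r ∤ pN`, where
`ℚ(E[p^n])/ℚ` is unramified (Néron–Ogg–Shafarevich), so `K ∩ ℚ(E[p^n]) = ℚ` and `Gal(K(E[p^n])/K) ≃
Gal(ℚ(E[p^n])/ℚ)` for all `n` (hypotheses stronger than print ⇒ fact weaker than print); `K` imaginary
quadratic, `d_K ≠ −3, −4` (H; = Z's `D_K < −4`), Heegner hypothesis for `N` = `SatisfiesHeegnerHypothesis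
N K`; ANY frame `(Dt, β, ι)` (H: "Fixing a modular parametrization"; the orientation `β² ≡ d_K (4N)`
is carried by the datum; `ι` the embedding); Kolyvagin primes with `M(ℓ) ≥ 1` and `n ∈ 𝒩^{(1)}` =
`KolyvaginDescent.KolSupp (Zhang2014.IsKolyvaginPrime N W K p) n` (Z §2.1: `I_l ⊆ pℤ_p` iff `p ∣ l+1`,
`p ∣ a_l`; `l` inert, `l ∤ NDp`); `c_1(n)` = `d.kolyvaginClass _ 1 ∈ H¹(K, E[p])`, McCallum's cocycle
of `P(n) = Σ_{σ∈S} σ D_n y(n)` — Howard's `κ_n` reduced mod `p` up to the automorphism `χ_n` of Thm.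
1.7.5 and the `⊗ G_n`-twist (neither changes vanishing), exactly the reading of the Zanarella Prop. 2.18
record `Zanarella2019_kolyvaginClass_one_ne_zero_of_not_divisible`. HYPOTHESIS `κ̄ ≠ 0`: some `n₀ ∈ Λ`
and datum `d₀` of conductor `n₀` on the frame with `c_1(n₀) ≠ 0` (the CONCLUSION of that record).
CONCLUSION: `n ∈ Λ`, a datum `d` of conductor `n` on the same frame with `c_1(n) ≠ 0`, `ν(n) = #{ℓ ∣ n}`
minimal among the non-zero level-one classes of the frame, and EITHER `#Sel_p(E/ℚ) = p^{ν(n)+1} ∧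
#Sel_p(E^{(d_K)}/ℚ) ≤ p^{ν(n)}` OR the same with the two curves exchanged (`Sel_p` = `W.selmerGroup p`,
the twist `W.quadraticTwist d_K`, as in the W. Zhang Lemma 8.4 record). Weaker than print where it
differs (sign `ε_ν` forgotten; surjectivity over `ℚ` for the whole tower; the choices inside a datum are
the sources' arbitrary fixed choices, on which vanishing of `c_1(n)` does not depend, so hypothesis and
conclusion quantify over some datum). Size XL (Howard's generalised Cassels–Tate pairing and Thm. 1.4.2,
the Kolyvagin-system axioms for the Heegner classes, Zanarella's §2.2); no `_holds` expected; nothing is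
asserted — users take `(h : HowardZanarella_exists_minimal_kolyvaginClass_one_selmerCard_of_ne_zero)`.
-- TODO(general form): Howard/Zanarella for any principal Artinian / DVR coefficient ring `R` and any Selmer triple with H.0–H.5 (core vertices, `κ_n R = 𝔪^d 𝓗(n)`); here only `R = 𝔽_p`, `T̄ = E[p]`, Heegner points on `X₀(N)`.
[cite: Howard2004, Thm. 1 and §1.7 with Thm. 1.7.5 (arXiv:1202.6340 held text p0003 L23–L70, p0012 L124–L139, p0014 L26–L38); Def. 1.2.1–1.2.3 (p0006 L63 – p0007 L12); Thm. 1.4.2 and (1.5) (p0010 L45–L55); Def. 1.5.2, Lemma 1.5.3 (p0009 L135–L148); Def. 1.5.4, Prop. 1.5.5 (p0010 L57–L77); Lemma 1.6.4 (p0011 L122–L149, p0012 L1–L27); Thm. 1.6.5, proof (p0012 L75–L116)]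
[cite: Zanarella2019, §2.1 Def. 2.1, §2.2 Lemma 2.2, Def. 2.4, Def. 2.7, Lemma 2.8, Cor. 2.12, Thm. 2.13, Cor. 2.14, Prop. 2.15 (arXiv:1908.09197 held text p0007 L34 – p0010 L74); §2.3 Def. 2.17, Prop. 2.18 with proof, Rem. 2.20 (p0010 L76 – p0011 L51); §3.1 (p0014 L1–L70)]
[cite: Kolyvagin1991MathAnn, §2, the paragraph before Thm. 4 (the eigenspaces `S^ν_{ℓ^n}` as Selmer groups over `ℚ` of `E` and of its form over `K`)]
[cite: WZhang2014, Def. 8.3 and Lemma 8.4 (1) (p. 236); Notations (xii)]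
[file NumberTheory/EllipticCurves/HeegnerPointsKolyvaginModPRigidity] -/
def HowardZanarella_exists_minimal_kolyvaginClass_one_selmerCard_of_ne_zero : Prop :=
  ∀ (W : WeierstrassCurve ℚ) [W.IsElliptic] [W.IsGloballyMinimal] (p : ℕ) [hp : Fact p.Prime],
    5 ≤ p → W.HasGoodReductionAtPrime p → W.HasSurjectiveModNGaloisRep p →
    (∀ n : ℕ, W.HasSurjectiveModNGaloisRep (p ^ n : ℕ)) →
    ∀ (K : Type) [Field K] [NumberField K], IsImaginaryQuadratic K →
      NumberField.discr K ≠ -3 → NumberField.discr K ≠ -4 →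
      ¬ ((p : ℤ) ∣ NumberField.discr K) →
      IsCoprime (NumberField.discr K) ((W.conductorNorm ℤ : ℕ) : ℤ) →
      ∀ [NeZero (W.conductorNorm ℤ)], SatisfiesHeegnerHypothesis (W.conductorNorm ℤ) K →
      ∀ (Dt : ModularParametrizationData W (W.conductorNorm ℤ)) (β : ℤ) (ι : K →+* ℂ),
        (∃ (n₀ : ℕ) (d₀ : KolyvaginHeegnerData Dt β ι n₀),
            KolyvaginDescent.KolSupp (Zhang2014.IsKolyvaginPrime (W.conductorNorm ℤ) W K p) n₀ ∧
              d₀.kolyvaginClass hp.out 1 ≠ 0) →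
        ∃ (n : ℕ) (d : KolyvaginHeegnerData Dt β ι n),
          KolyvaginDescent.KolSupp (Zhang2014.IsKolyvaginPrime (W.conductorNorm ℤ) W K p) n ∧
            d.kolyvaginClass hp.out 1 ≠ 0 ∧
            (∀ (n' : ℕ) (d' : KolyvaginHeegnerData Dt β ι n'),
              KolyvaginDescent.KolSupp (Zhang2014.IsKolyvaginPrime (W.conductorNorm ℤ) W K p) n' →
              d'.kolyvaginClass hp.out 1 ≠ 0 → n.primeFactors.card ≤ n'.primeFactors.card) ∧
            ((Nat.card (W.selmerGroup p) = p ^ (n.primeFactors.card + 1) ∧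
                Nat.card ((W.quadraticTwist (NumberField.discr K : ℚ)).selmerGroup p) ≤
                  p ^ n.primeFactors.card) ∨
              (Nat.card ((W.quadraticTwist (NumberField.discr K : ℚ)).selmerGroup p) =
                  p ^ (n.primeFactors.card + 1) ∧
                Nat.card (W.selmerGroup p) ≤ p ^ n.primeFactors.card))

end Literature.NumberTheory.EllipticCurves
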